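import Literature.Computability.AlgebraicComplexity.KoszulFlatteningBorderRank
import HarnessLib

/-!
# The tangency flattening of Doležálek–Michałek and its border-rank bound — proved

Topic `Literature/Computability/AlgebraicComplexity`.  Doležálek–Michałek, *Nonlinear methods for
tensors: determinantal equations for secant varieties beyond cactus* (arXiv:2602.12762, 2026), §3,
introduce KRONECKER–KOSZUL flattenings: matrices depending POLYNOMIALLY (here: quadratically) on a
tensor `t ∈ V₁ ⊗ V₂ ⊗ V₃` whose minors vanish on secant varieties (Thm 3.3 / Cor 3.5).  The
simplest new member is the **tangency flattening** (the paragraph before Cor 3.9)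

  `Tang(t) : Λ³V₁* ⊗ V₂* ⊗ V₃* → V₁* ⊗ V₂ ⊗ V₃`,   `Tang(t) = (t ⊗ t ⊗ id_{V₁})` contracted and skew-symmetrised,

and Cor 3.9: if `dim V₁ = dim V₂ = dim V₃ = n` and `R̲(t) ≤ q` then `rank Tang(t) ≤ q(q-1)(n-2)`.
This file defines the tangency flattening in coordinates, for an arbitrary format
`t : ι → κ → μ → R` (the exterior factor is the first one, `ι`), and PROVES the bound

  `rank Tang(t) ≤ R̲(t) · (R̲(t) - 1) · (|ι| - 2)`      (`rank_tangencyFlattening_le`)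

for the tree's algebraic border rank `algBorderRank` over `K[ε]` (`SchoenhageTau.lean`, Bläser 2013,
Def. 6.1), over any field `K`; the cubic case is Cor 3.9 as printed, the general case is Thm 3.3 /
Cor 3.5 specialised to this flattening (`F(q) = q(q-1)` proper colourings of one edge, times
`C(dim V₁ - 2, 1)`).  The contrapositive `le_algBorderRank_of_lt_rank_tangencyFlattening` is the form
used for lower bounds (e.g. `R̲(⟨2,2,2⟩) = 7` in §5.1 of the paper, `TangencyFlatteningMatMulTwo.lean`).

## Coordinates

Row index `(s₁, s₂, s₃, b, c') ∈ ι³ × κ × μ` (all triples; rows with a repeated `sᵢ` vanish and rows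
differing by a permutation of `(s₁,s₂,s₃)` agree up to sign, so the rank is that of the `Λ³`
version), column index `(d, b', c) ∈ ι × κ × μ`, entry

  `Tang(t)_{(S,b,c'),(d,b',c)} = det [ t(·,b,c) ; t(·,b',c') ; e_d ]_S`

(`det3Single`: the `3 × 3` determinant with rows the two slices `t(·,b,c), t(·,b',c') ∈ R^ι` and
the coordinate vector `e_d`, columns `S = (s₁,s₂,s₃)`).  One copy of `t` takes its `κ`-index from the
row and its `μ`-index from the column, the other copy the reverse — this is the pairing of the two
tensor copies in DM26 §3 (blocks `λ_{1,1} = {1,2}`, `d'_{1,1} = 1`; `λ_{2,j}, λ_{3,j}` singletons).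

## The proof (DM26, proof of Thm 3.3, made elementary for this flattening)

`Tang` is the diagonal of the bilinear `tangencyPairing s t`.  For triads,
`tangencyPairing (a⊗β⊗γ) (a'⊗β'⊗γ') = E · K(a,a') · G` with `K(a,a')_{S,d} = det[a; a'; e_d]_S`
(`tangencyPairing_triad_triad`), and `rank K(a,a') ≤ |ι| - 2` because `a, a' ∈ ker K(a,a')`
(`rank_pairMinorMatrix_le`); the diagonal terms vanish (`K(a,a) = 0`).  Hence for
`t = ∑_{ρ<q} a_ρ ⊗ β_ρ ⊗ γ_ρ`, `rank Tang(t) ≤ ∑_{ρ ≠ σ} (|ι| - 2) = q(q-1)(|ι|-2)`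
(`rank_tangencyFlattening_sum_triad_le`).  Border rank: if `T = ∑_{ρ<q} u_ρ ⊗ v_ρ ⊗ w_ρ = εʰ(t + ε T')`
over `K[ε]` then, `Tang` being quadratic, `Tang(T) = ε^{2h} (Tang(t) + ε M₁)`, so over `K(ε)`
`rank Tang(t) ≤ rank Tang(T) ≤ q(q-1)(|ι|-2)` by `rank_le_rank_map_of_perturbation`
(`KoszulFlatteningBorderRank.lean`) and the rank bound over the field `K(ε)`.

Everything here is PROVED.  Not here: the general Kronecker–Koszul / Kronecker–Young flattenings
of DM26 §3–4, Thm 1.1 (non-vanishing on cactus varieties), Conj. 6.1.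

References: T. Doležálek, M. Michałek, arXiv:2602.12762 (2026), Thm 3.3, Cor 3.5, Cor 3.9, §5.1
[DolezalekMichalek2026]; M. Bläser, *Fast Matrix Multiplication*, Theory of Computing Library,
Graduate Surveys 5 (2013), Def. 6.1 [Blaser2013].
-/

noncomputable section

open scoped BigOperators Polynomial
open Matrix Polynomial

namespace Literature.Computability.AlgebraicComplexity

universe u v₀ v₁ v₂

/-! ## Definitions -/

section Defs

variable {R : Type u} [CommRing R] {ι : Type v₀} {κ : Type v₁} {μ : Type v₂} [DecidableEq ι]

/-- `det3Single x y d S`: the `3 × 3` determinant with rows `x, y, e_d ∈ R^ι` and columns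
`S = (s₁, s₂, s₃)`, expanded along the row `e_d`:
`[s₁ = d](x_{s₂} y_{s₃} - x_{s₃} y_{s₂}) - [s₂ = d](x_{s₁} y_{s₃} - x_{s₃} y_{s₁}) + [s₃ = d](x_{s₁} y_{s₂} - x_{s₂} y_{s₁})`.
[cite: DolezalekMichalek2026, §3 (before Cor 3.9)] -/
def det3Single (x y : ι → R) (d : ι) (S : ι × ι × ι) : R :=
  (if S.1 = d then x S.2.1 * y S.2.2 - x S.2.2 * y S.2.1 else 0) -
    (if S.2.1 = d then x S.1 * y S.2.2 - x S.2.2 * y S.1 else 0) +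
    (if S.2.2 = d then x S.1 * y S.2.1 - x S.2.1 * y S.1 else 0)

/-- The bilinear **tangency pairing** of two tensors `s, t ∈ R^ι ⊗ R^κ ⊗ R^μ`: the matrix with rows
`(s₁, s₂, s₃, b, c') ∈ ι³ × κ × μ`, columns `(d, b', c) ∈ ι × κ × μ` and entry
`det [ s(·,b,c) ; t(·,b',c') ; e_d ]_{(s₁,s₂,s₃)}`; the tangency flattening is its diagonal
`tangencyPairing t t`. [cite: DolezalekMichalek2026, §3 (before Cor 3.9)] -/
def tangencyPairing (s t : ι → κ → μ → R) : Matrix (ι × ι × ι × κ × μ) (ι × κ × μ) R :=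
  Matrix.of fun r c =>
    det3Single (fun a => s a r.2.2.2.1 c.2.2) (fun a => t a c.2.1 r.2.2.2.2) c.1 (r.1, r.2.1, r.2.2.1)

/-- The **tangency flattening** `Tang(t) : Λ³V₁* ⊗ V₂* ⊗ V₃* → V₁* ⊗ V₂ ⊗ V₃` of Doležálek–Michałek in
coordinates (all of `ι³` as row index, see the module docstring):
`Tang(t)_{(S,b,c'),(d,b',c)} = det [ t(·,b,c) ; t(·,b',c') ; e_d ]_S`.
[cite: DolezalekMichalek2026, §3 (before Cor 3.9)] -/
def tangencyFlattening (t : ι → κ → μ → R) : Matrix (ι × ι × ι × κ × μ) (ι × κ × μ) R :=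
  tangencyPairing t t

/-- The matrix `K(x,y) : R^ι → R^{ι³}`, `K(x,y)_{S,d} = det [x; y; e_d]_S`, i.e. `K(x,y) z = (det [x; y; z]_S)_S`
(the `2 × 2` minors of `(x, y)` paired with a third vector). [folklore] -/
def pairMinorMatrix (x y : ι → R) : Matrix (ι × ι × ι) ι R :=
  Matrix.of fun S d => det3Single x y d S

/-! ### Entries and (bi)linearity -/

/-- Entries of the tangency pairing. [cite: DolezalekMichalek2026, §3 (before Cor 3.9)] -/
theorem tangencyPairing_apply (s t : ι → κ → μ → R) (r : ι × ι × ι × κ × μ) (c : ι × κ × μ) :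
    tangencyPairing s t r c =
      det3Single (fun a => s a r.2.2.2.1 c.2.2) (fun a => t a c.2.1 r.2.2.2.2) c.1 (r.1, r.2.1, r.2.2.1) :=
  rfl

/-- Entries of the tangency flattening. [cite: DolezalekMichalek2026, §3 (before Cor 3.9)] -/
theorem tangencyFlattening_apply (t : ι → κ → μ → R) (r : ι × ι × ι × κ × μ) (c : ι × κ × μ) :
    tangencyFlattening t r c =
      det3Single (fun a => t a r.2.2.2.1 c.2.2) (fun a => t a c.2.1 r.2.2.2.2) c.1 (r.1, r.2.1, r.2.2.1) :=
  rfl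

/-- `det3Single` is additive in the first row. [folklore] -/
theorem det3Single_add_left (x₁ x₂ y : ι → R) (d : ι) (S : ι × ι × ι) :
    det3Single (x₁ + x₂) y d S = det3Single x₁ y d S + det3Single x₂ y d S := by
  simp only [det3Single, Pi.add_apply]
  split_ifs <;> ring

/-- `det3Single` is additive in the second row. [folklore] -/
theorem det3Single_add_right (x y₁ y₂ : ι → R) (d : ι) (S : ι × ι × ι) :
    det3Single x (y₁ + y₂) d S = det3Single x y₁ d S + det3Single x y₂ d S := by
  simp only [det3Single, Pi.add_apply]
  split_ifs <;> ring

/-- `det3Single` is homogeneous in the first row. [folklore] -/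
theorem det3Single_smul_left (a : R) (x y : ι → R) (d : ι) (S : ι × ι × ι) :
    det3Single (a • x) y d S = a * det3Single x y d S := by
  simp only [det3Single, Pi.smul_apply, smul_eq_mul]
  split_ifs <;> ring

/-- `det3Single` is homogeneous in the second row. [folklore] -/
theorem det3Single_smul_right (a : R) (x y : ι → R) (d : ι) (S : ι × ι × ι) :
    det3Single x (a • y) d S = a * det3Single x y d S := by
  simp only [det3Single, Pi.smul_apply, smul_eq_mul]
  split_ifs <;> ring

/-- `det3Single` vanishes on proportional rows (second row a multiple of the first). [folklore] -/
theorem det3Single_self_smul (x : ι → R) (a : R) (d : ι) (S : ι × ι × ι) :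
    det3Single x (a • x) d S = 0 := by
  simp only [det3Single, Pi.smul_apply, smul_eq_mul]
  split_ifs <;> ring

/-- `det3Single` vanishes on proportional rows (first row a multiple of the second). [folklore] -/
theorem det3Single_smul_self (y : ι → R) (a : R) (d : ι) (S : ι × ι × ι) :
    det3Single (a • y) y d S = 0 := by
  simp only [det3Single, Pi.smul_apply, smul_eq_mul]
  split_ifs <;> ring

/-- `det3Single` with equal rows vanishes. [folklore] -/
theorem det3Single_self (x : ι → R) (d : ι) (S : ι × ι × ι) : det3Single x x d S = 0 := by
  simpa using det3Single_self_smul x 1 d S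

/-- `det3Single` commutes with ring homomorphisms. [folklore] -/
theorem map_det3Single {R' : Type*} [CommRing R'] (f : R →+* R') (x y : ι → R) (d : ι)
    (S : ι × ι × ι) : f (det3Single x y d S) = det3Single (f ∘ x) (f ∘ y) d S := by
  simp only [det3Single, Function.comp_apply]
  split_ifs <;> simp [map_sub, map_add, map_mul]

/-- Additivity of the pairing in the first tensor. [folklore] -/
theorem tangencyPairing_add_left (s₁ s₂ t : ι → κ → μ → R) :
    tangencyPairing (s₁ + s₂) t = tangencyPairing s₁ t + tangencyPairing s₂ t := by
  ext r c
  simp only [tangencyPairing_apply, Matrix.add_apply, det3Single, Pi.add_apply]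
  split_ifs <;> ring

/-- Additivity of the pairing in the second tensor. [folklore] -/
theorem tangencyPairing_add_right (s t₁ t₂ : ι → κ → μ → R) :
    tangencyPairing s (t₁ + t₂) = tangencyPairing s t₁ + tangencyPairing s t₂ := by
  ext r c
  simp only [tangencyPairing_apply, Matrix.add_apply, det3Single, Pi.add_apply]
  split_ifs <;> ring

/-- Homogeneity of the pairing in the first tensor. [folklore] -/
theorem tangencyPairing_smul_left (a : R) (s t : ι → κ → μ → R) :
    tangencyPairing (a • s) t = a • tangencyPairing s t := by
  ext r c
  simp only [tangencyPairing_apply, Matrix.smul_apply, smul_eq_mul, det3Single, Pi.smul_apply]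
  split_ifs <;> ring

/-- Homogeneity of the pairing in the second tensor. [folklore] -/
theorem tangencyPairing_smul_right (a : R) (s t : ι → κ → μ → R) :
    tangencyPairing s (a • t) = a • tangencyPairing s t := by
  ext r c
  simp only [tangencyPairing_apply, Matrix.smul_apply, smul_eq_mul, det3Single, Pi.smul_apply]
  split_ifs <;> ring

/-- The pairing with `0` on the left vanishes. [folklore] -/
theorem tangencyPairing_zero_left (t : ι → κ → μ → R) : tangencyPairing 0 t = 0 := by
  have h := tangencyPairing_smul_left (0 : R) (0 : ι → κ → μ → R) t
  rwa [zero_smul, zero_smul] at h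

/-- The pairing with `0` on the right vanishes. [folklore] -/
theorem tangencyPairing_zero_right (s : ι → κ → μ → R) : tangencyPairing s 0 = 0 := by
  have h := tangencyPairing_smul_right (0 : R) s (0 : ι → κ → μ → R)
  rwa [zero_smul, zero_smul] at h

/-- The pairing of finite sums expands bilinearly. [folklore] -/
theorem tangencyPairing_sum_sum {σ : Type*} (A : Finset σ) (f g : σ → ι → κ → μ → R) :
    tangencyPairing (∑ i ∈ A, f i) (∑ j ∈ A, g j) = ∑ i ∈ A, ∑ j ∈ A, tangencyPairing (f i) (g j) := by
  classical
  have hleft : ∀ t : ι → κ → μ → R, ∀ B : Finset σ,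
      tangencyPairing (∑ i ∈ B, f i) t = ∑ i ∈ B, tangencyPairing (f i) t := by
    intro t B
    induction B using Finset.induction_on with
    | empty => simp [tangencyPairing_zero_left]
    | insert a B ha ih => rw [Finset.sum_insert ha, Finset.sum_insert ha, tangencyPairing_add_left, ih]
  have hright : ∀ s : ι → κ → μ → R, ∀ B : Finset σ,
      tangencyPairing s (∑ j ∈ B, g j) = ∑ j ∈ B, tangencyPairing s (g j) := by
    intro s B
    induction B using Finset.induction_on with
    | empty => simp [tangencyPairing_zero_right]
    | insert a B ha ih => rw [Finset.sum_insert ha, Finset.sum_insert ha, tangencyPairing_add_right, ih]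
  rw [hleft]
  exact Finset.sum_congr rfl fun i _ => hright _ _

/-- **Base change**: the tangency pairing commutes with ring homomorphisms applied entrywise.
[folklore] -/
theorem tangencyPairing_map {R' : Type*} [CommRing R'] (f : R →+* R') (s t : ι → κ → μ → R) :
    (tangencyPairing s t).map f =
      tangencyPairing (fun a b c => f (s a b c)) (fun a b c => f (t a b c)) := by
  ext r c
  simp only [Matrix.map_apply, tangencyPairing_apply, map_det3Single]
  rfl

/-- Base change for the tangency flattening. [folklore] -/
theorem tangencyFlattening_map {R' : Type*} [CommRing R'] (f : R →+* R') (t : ι → κ → μ → R) :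
    (tangencyFlattening t).map f = tangencyFlattening (fun a b c => f (t a b c)) :=
  tangencyPairing_map f t t

/-- The flattening is QUADRATIC in the tensor:
`Tang(a (s + x t')) = a² (Tang(s) + x (⟨s,t'⟩ + ⟨t',s⟩ + x Tang(t')))`. [folklore] -/
theorem tangencyFlattening_smul_add (a x : R) (s t' : ι → κ → μ → R) :
    tangencyFlattening (a • (s + x • t')) =
      (a * a) • (tangencyFlattening s +
        x • (tangencyPairing s t' + tangencyPairing t' s + x • tangencyPairing t' t')) := by
  ext r c
  simp only [tangencyFlattening, tangencyPairing_apply, Matrix.smul_apply, Matrix.add_apply,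
    Pi.smul_apply, Pi.add_apply, smul_eq_mul, det3Single]
  split_ifs <;> ring

/-! ### Triads: the factorisation through the `2 × 2`-minor matrix `K(a, a')` -/

variable [Fintype ι]

/-- On triads the pairing factors through `K(w, w')`:
`tangencyPairing (w⊗u⊗v) (w'⊗u'⊗v')_{(S,b,c'),(d,b',c)} = (u_b v'_{c'}) · (u'_{b'} v_c) · K(w,w')_{S,d}`.
[cite: DolezalekMichalek2026, Thm 3.3 (proof)] -/
theorem tangencyPairing_triad_triad (w w' : ι → R) (u u' : κ → R) (v v' : μ → R) :
    tangencyPairing (triad w u v) (triad w' u' v') =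
      (Matrix.of fun (r : ι × ι × ι × κ × μ) (S : ι × ι × ι) =>
          if (r.1, r.2.1, r.2.2.1) = S then u r.2.2.2.1 * v' r.2.2.2.2 else 0) *
        pairMinorMatrix w w' *
        (Matrix.of fun (d : ι) (c : ι × κ × μ) => if d = c.1 then u' c.2.1 * v c.2.2 else 0) := by
  ext r c
  rw [Matrix.mul_apply, Fintype.sum_eq_single c.1]
  · rw [Matrix.mul_apply, Fintype.sum_eq_single (r.1, r.2.1, r.2.2.1)]
    · simp only [Matrix.of_apply, if_true, tangencyPairing_apply, pairMinorMatrix, triad_apply,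
        det3Single]
      split_ifs <;> ring
    · intro S hS
      simp only [Matrix.of_apply, if_neg (Ne.symm hS), zero_mul]
  · intro d hd
    simp only [Matrix.of_apply, if_neg hd, mul_zero]
  -- (instances for `Fintype` on the row/column index products are found automatically)

end Defs

/-! ## Rank bounds over a field -/

section Rank

variable {K : Type u} [Field K] {ι : Type v₀} {κ : Type v₁} {μ : Type v₂} [DecidableEq ι]
variable [Fintype ι] [Fintype κ] [Fintype μ]

/-- `K(x,y) z` is the vector of `3 × 3` determinants `det [x; y; z]_S`. [folklore] -/
theorem pairMinorMatrix_mulVec (x y z : ι → K) (S : ι × ι × ι) :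
    (pairMinorMatrix x y).mulVec z S =
      z S.1 * (x S.2.1 * y S.2.2 - x S.2.2 * y S.2.1) - z S.2.1 * (x S.1 * y S.2.2 - x S.2.2 * y S.1) +
        z S.2.2 * (x S.1 * y S.2.1 - x S.2.1 * y S.1) := by
  simp only [Matrix.mulVec, dotProduct, pairMinorMatrix, Matrix.of_apply, det3Single, sub_mul,
    add_mul, ite_mul, zero_mul, Finset.sum_add_distrib, Finset.sum_sub_distrib, Finset.sum_ite_eq,
    Finset.mem_univ, if_true]
  ring

/-- `x ∈ ker K(x,y)`. [folklore] -/
theorem pairMinorMatrix_mulVec_left (x y : ι → K) : (pairMinorMatrix x y).mulVec x = 0 := by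
  funext S
  rw [pairMinorMatrix_mulVec, Pi.zero_apply]
  ring

/-- `y ∈ ker K(x,y)`. [folklore] -/
theorem pairMinorMatrix_mulVec_right (x y : ι → K) : (pairMinorMatrix x y).mulVec y = 0 := by
  funext S
  rw [pairMinorMatrix_mulVec, Pi.zero_apply]
  ring

/-- **`rank K(x,y) ≤ |ι| - 2`**: if `x, y` are independent they span a `2`-dimensional subspace of
the kernel; if they are dependent, `K(x,y) = 0`. [cite: DolezalekMichalek2026, Thm 3.3 (proof)] -/
theorem rank_pairMinorMatrix_le (x y : ι → K) :
    (pairMinorMatrix x y).rank ≤ Fintype.card ι - 2 := by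
  classical
  by_cases hli : LinearIndependent K ![x, y]
  · -- rank-nullity with `span {x, y} ≤ ker`
    have hker : Submodule.span K (Set.range ![x, y]) ≤ LinearMap.ker (pairMinorMatrix x y).mulVecLin := by
      rw [Submodule.span_le]
      rintro _ ⟨i, rfl⟩
      rw [SetLike.mem_coe, LinearMap.mem_ker, Matrix.mulVecLin_apply]
      fin_cases i
      · exact pairMinorMatrix_mulVec_left x y
      · exact pairMinorMatrix_mulVec_right x y
    have h2 : Module.finrank K (Submodule.span K (Set.range ![x, y])) = 2 := by
      rw [finrank_span_eq_card hli, Fintype.card_fin]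
    have hrn := LinearMap.finrank_range_add_finrank_ker (pairMinorMatrix x y).mulVecLin
    rw [Module.finrank_fintype_fun_eq_card] at hrn
    have hmono := Submodule.finrank_mono hker
    rw [h2] at hmono
    unfold Matrix.rank
    omega
  · -- dependent rows: the matrix vanishes
    rw [LinearIndependent.pair_iff] at hli
    push Not at hli
    obtain ⟨s, t, hst, hst0⟩ := hli
    have hzero : pairMinorMatrix x y = 0 := by
      by_cases hs : s = 0
      · have ht : t ≠ 0 := hst0 hs
        have hy : y = 0 := by
          rw [hs, zero_smul, zero_add] at hst
          exact (smul_eq_zero.1 hst).resolve_left ht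
        ext S d
        simp only [pairMinorMatrix, Matrix.of_apply, Matrix.zero_apply, hy]
        simpa using det3Single_self_smul x (0 : K) d S
      · have hx : x = (-(t / s)) • y := by
          have : s • x = -(t • y) := eq_neg_of_add_eq_zero_left hst
          calc x = s⁻¹ • (s • x) := by rw [smul_smul, inv_mul_cancel₀ hs, one_smul]
            _ = (-(t / s)) • y := by rw [this, smul_neg, smul_smul, ← neg_smul, div_eq_inv_mul]
        ext S d
        simp only [pairMinorMatrix, Matrix.of_apply, Matrix.zero_apply, hx]
        exact det3Single_smul_self y _ d S
    rw [hzero, Matrix.rank_zero]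
    exact Nat.zero_le _

/-- The pairing of two triads has rank `≤ |ι| - 2`. [cite: DolezalekMichalek2026, Thm 3.3 (proof)] -/
theorem rank_tangencyPairing_triad_triad_le (w w' : ι → K) (u u' : κ → K) (v v' : μ → K) :
    (tangencyPairing (triad w u v) (triad w' u' v')).rank ≤ Fintype.card ι - 2 := by
  rw [tangencyPairing_triad_triad]
  exact (Matrix.rank_mul_le_left _ _).trans
    ((Matrix.rank_mul_le_right _ _).trans (rank_pairMinorMatrix_le w w'))

omit [Fintype κ] [Fintype μ] in
/-- The pairing of a triad with itself vanishes (the diagonal terms of DM26's expansion).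
[cite: DolezalekMichalek2026, Thm 3.3 (proof)] -/
theorem tangencyPairing_triad_self (w : ι → K) (u : κ → K) (v : μ → K) :
    tangencyPairing (triad w u v) (triad w u v) = 0 := by
  have hK : pairMinorMatrix (R := K) w w = 0 := by
    ext S d
    simp only [pairMinorMatrix, Matrix.of_apply, Matrix.zero_apply]
    exact det3Single_self w d S
  rw [tangencyPairing_triad_triad, hK, Matrix.mul_zero, Matrix.zero_mul]

/-- **Rank of the tangency flattening of a sum of `q` triads**:
`rank Tang(∑_{ρ<q} w_ρ ⊗ u_ρ ⊗ v_ρ) ≤ q(q-1)(|ι|-2)`. [cite: DolezalekMichalek2026, Thm 3.3 / Cor 3.9] -/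
theorem rank_tangencyFlattening_sum_triad_le {q : ℕ} (w : Fin q → ι → K) (u : Fin q → κ → K)
    (v : Fin q → μ → K) :
    (tangencyFlattening (∑ ρ, triad (w ρ) (u ρ) (v ρ))).rank ≤ q * (q - 1) * (Fintype.card ι - 2) := by
  classical
  rw [tangencyFlattening, tangencyPairing_sum_sum]
  refine (matrix_rank_sum_le _ _).trans ?_
  have hinner : ∀ ρ : Fin q, (∑ σ, tangencyPairing (triad (w ρ) (u ρ) (v ρ))
      (triad (w σ) (u σ) (v σ))).rank ≤ (q - 1) * (Fintype.card ι - 2) := by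
    intro ρ
    refine (matrix_rank_sum_le _ _).trans ?_
    rw [← Finset.sum_erase_add _ _ (Finset.mem_univ ρ), tangencyPairing_triad_self, Matrix.rank_zero,
      add_zero]
    calc ∑ σ ∈ Finset.univ.erase ρ, (tangencyPairing (triad (w ρ) (u ρ) (v ρ))
            (triad (w σ) (u σ) (v σ))).rank
        ≤ ∑ _σ ∈ Finset.univ.erase ρ, (Fintype.card ι - 2) :=
          Finset.sum_le_sum fun σ _ => rank_tangencyPairing_triad_triad_le _ _ _ _ _ _
      _ = (q - 1) * (Fintype.card ι - 2) := by
          rw [Finset.sum_const, smul_eq_mul, Finset.card_erase_of_mem (Finset.mem_univ ρ),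
            Finset.card_univ, Fintype.card_fin]
  calc ∑ ρ, (∑ σ, tangencyPairing (triad (w ρ) (u ρ) (v ρ)) (triad (w σ) (u σ) (v σ))).rank
      ≤ ∑ _ρ : Fin q, (q - 1) * (Fintype.card ι - 2) := Finset.sum_le_sum fun ρ _ => hinner ρ
    _ = q * (q - 1) * (Fintype.card ι - 2) := by
        rw [Finset.sum_const, smul_eq_mul, Finset.card_univ, Fintype.card_fin, mul_assoc]

/-- The tangency flattening bound for RANK: `rank Tang(t) ≤ R(t)(R(t)-1)(|ι|-2)`.
[cite: DolezalekMichalek2026, Cor 3.9] -/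
theorem rank_tangencyFlattening_le_of_tensorRank (t : ι → κ → μ → K) :
    (tangencyFlattening t).rank ≤ tensorRank t * (tensorRank t - 1) * (Fintype.card ι - 2) := by
  obtain ⟨w, u, v, ht⟩ := exists_triad_decomposition_tensorRank t
  have h := rank_tangencyFlattening_sum_triad_le w u v
  rwa [← ht] at h

end Rank

/-! ## The border rank bound -/

section BorderRank

variable {K : Type u} [Field K] {ι : Type v₀} {κ : Type v₁} {μ : Type v₂} [DecidableEq ι]
variable [Fintype ι] [Fintype κ] [Fintype μ]

/-- **Doležálek–Michałek, Cor 3.9 (Thm 3.3 / Cor 3.5 for the tangency flattening), for border rank**: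
for every tensor `t ∈ K^ι ⊗ K^κ ⊗ K^μ` over a field,
`rank Tang(t) ≤ R̲(t) · (R̲(t) - 1) · (|ι| - 2)` for the algebraic border rank `R̲ = algBorderRank`
over `K[ε]`; i.e. the `(q(q-1)(|ι|-2) + 1)`-minors of `Tang` are equations for border rank `≤ q`.
[cite: DolezalekMichalek2026, Cor 3.9] -/
theorem rank_tangencyFlattening_le [DecidableEq κ] [DecidableEq μ] (t : ι → κ → μ → K) :
    (tangencyFlattening t).rank ≤
      algBorderRank t * (algBorderRank t - 1) * (Fintype.card ι - 2) := by
  classical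
  -- the border rank is attained at some order `h`, by a decomposition with `r` triads
  obtain ⟨h, hh⟩ : ∃ h, approxRank h t = algBorderRank t := by
    obtain ⟨h, hh⟩ := Nat.sInf_mem (Set.range_nonempty fun h : ℕ => approxRank h t)
    exact ⟨h, hh⟩
  obtain ⟨u, v, w, huvw⟩ := Nat.sInf_mem (exists_isApproxDecomposition h t)
  set r := approxRank h t with hr
  -- the polynomial tensor `T = ∑ u ⊗ v ⊗ w = εʰ (t + ε T')`
  set T : ι → κ → μ → K[X] := ∑ ρ, triad (u ρ) (v ρ) (w ρ) with hTdef
  have hT : ∀ a b c, ∀ j ≤ h, (T a b c).coeff j = if j = h then t a b c else 0 := by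
    intro a b c j hj
    rw [← huvw a b c j hj, hTdef]
    simp only [Finset.sum_apply, triad_apply]
  have hdvd : ∀ a b c, X ^ (h + 1) ∣ T a b c - C (t a b c) * X ^ h := by
    intro a b c
    rw [X_pow_dvd_iff]
    intro d hd
    rw [coeff_sub, coeff_C_mul_X_pow, hT a b c d (by omega)]
    split_ifs <;> simp
  choose T' hT' using hdvd
  have hTe : T = (X : K[X]) ^ h • ((fun a b c => C (t a b c)) + (X : K[X]) • T') := by
    funext a b c
    simp only [Pi.smul_apply, Pi.add_apply, smul_eq_mul]
    linear_combination hT' a b c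
  -- the flattening is quadratic: `Tang(T) = ε^{2h} (Tang(t) + ε M₁)`
  have hKF : tangencyFlattening T =
      ((X : K[X]) ^ h * (X : K[X]) ^ h) • ((tangencyFlattening t).map (C : K →+* K[X]) +
        (X : K[X]) • (tangencyPairing (fun a b c => C (t a b c)) T' +
          tangencyPairing T' (fun a b c => C (t a b c)) + (X : K[X]) • tangencyPairing T' T')) := by
    rw [tangencyFlattening_map, hTe, tangencyFlattening_smul_add]
  have hN : ∀ i j, tangencyFlattening T i j =
      (C (tangencyFlattening t i j) + X * (tangencyPairing (fun a b c => C (t a b c)) T' +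
          tangencyPairing T' (fun a b c => C (t a b c)) + (X : K[X]) • tangencyPairing T' T') i j) *
        X ^ (2 * h) := by
    intro i j
    rw [hKF]
    simp only [Matrix.smul_apply, Matrix.add_apply, Matrix.map_apply, smul_eq_mul]
    ring
  -- over the fraction field `L = K(ε)`
  let L := FractionRing K[X]
  have key := rank_le_rank_map_of_perturbation (L := L) (tangencyFlattening t) _
    (tangencyFlattening T) (2 * h) hN
  have hmapT : (fun a b c => algebraMap K[X] L (T a b c)) =
      ∑ ρ, triad (fun a => algebraMap K[X] L (u ρ a)) (fun b => algebraMap K[X] L (v ρ b))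
        (fun c => algebraMap K[X] L (w ρ c)) := by
    funext a b c
    simp only [hTdef, Finset.sum_apply, triad_apply, map_sum, map_mul]
  have hbound : ((tangencyFlattening T).map (algebraMap K[X] L)).rank ≤
      r * (r - 1) * (Fintype.card ι - 2) := by
    rw [tangencyFlattening_map, hmapT]
    exact rank_tangencyFlattening_sum_triad_le _ _ _
  rw [← hh]
  exact key.trans hbound

/-- The bound in the form used for lower bounds: if `rank Tang(t) > (R-1)(R-2)(|ι|-2)` then
`R ≤ R̲(t)` (for `R ≥ 1`; e.g. `|ι| = 4`, `rank > 60 ⇒ R̲ ≥ 7`). [cite: DolezalekMichalek2026, Cor 3.9] -/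
theorem le_algBorderRank_of_lt_rank_tangencyFlattening [DecidableEq κ] [DecidableEq μ]
    (t : ι → κ → μ → K) {R : ℕ}
    (hR : (R - 1) * (R - 2) * (Fintype.card ι - 2) < (tangencyFlattening t).rank) :
    R ≤ algBorderRank t := by
  have h := rank_tangencyFlattening_le t
  by_contra hlt
  push Not at hlt
  -- `bR ≤ R - 1`, and `q ↦ q (q-1)` is monotone
  have h1 : algBorderRank t ≤ R - 1 := by omega
  have h2 : algBorderRank t * (algBorderRank t - 1) ≤ (R - 1) * (R - 2) := by
    have h3 : algBorderRank t - 1 ≤ R - 2 := by omega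
    exact Nat.mul_le_mul h1 h3
  have h4 := Nat.mul_le_mul_right (Fintype.card ι - 2) h2
  exact absurd hR (not_lt.2 (h.trans h4))

end BorderRank

end Literature.Computability.AlgebraicComplexity

end
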